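import Summits.BirchSwinnertonDyer.BirchSwinnertonDyer.Theses.LeadingTerm
import Summits.BirchSwinnertonDyer.BirchSwinnertonDyer.Theses.PadicCornerSqueeze
import Literature.NumberTheory.EllipticCurves.KatoRankBound
import HarnessLib

/-!
# Crux `SelmerCapAtOnePrime` (stmt-BirchSwinnertonDyer-19215) — the pinch junction
# (crux-ideate r1, ideator k2 g5): the crux's Ш-surplus over UB is route-internally free
# in BOTH wanting routes

The crux (shared by routes LeadingTerm and PadicCornerSqueeze) reads
`∀ W elliptic globally minimal, 2 ≤ r_an → ∃ p, corank_{ℤ_p} Sel_{p^∞}(E/ℚ) ≤ r_an`, i.e.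
(`selmerCorank = rank + corank Ш[p^∞]`) UB (`rank ≤ r_an`) PLUS cofiniteness of `Ш[p^∞]` at one
prime, for every curve of analytic rank `≥ 2`. The CruxAttack (§3) and the k2 census flag the
surplus as over-strength modulo the sibling `GZKRankLeOne`. This file records, kernel-checked, that
the surplus is supplied INSIDE each wanting route by that route's own pinch crux together with Kato's
corank bound (Astérisque 295, Thm 18.4, tree fact `kato_selmerCorank_le_order_padicLFunction`, taken
∀-closed as a hypothesis exactly as in `Theorems/LeadingTermSqueezeUBR2Pinch.lean`):

* route LeadingTerm (`closes hC hP hUB`): `PinchPrime` (stmt-16218) gives a good ordinary `p ≥ 5` and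
  a newform `f` with `ord_T L_p(f,α) = rank`; Kato gives `corank ≤ ord_T L_p`; with `rank ≤ corank`
  this is `corank Sel_{p^∞} = rank` at the pinch prime, so
  `SelmerCapAtOnePrime ↔ NoExcessRankR2` (`rank ≤ r_an` whenever `r_an ≥ 2`) —
  `selmerCap_iff_noExcessRank_of_pinchPrime`; composing with the landed parity ratchet
  `Theorems.squeezeUBR2_of_pinchPrime_of_ub4` (file `LeadingTermSqueezeUBR2Pinch.lean`, not imported
  here to keep this check independent of that build cone) the crux follows from the GZK cell and the
  single cell UB4 = "four independent points and `w = +1` force `L''(E,1) = 0`".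
* route PadicCornerSqueeze (`closes h1 h2 h3 hR1 hmod hA`): its crux C2 `PadicOrderLeRankAtOnePrime`
  (stmt-19213: an odd good ordinary `p` with `ord_T L_p(f,α) ≤ rank` for every newform `f`) plus
  Kato plus the existence of a newform (the route's `Modularity` item, here as a hypothesis in the
  globally-minimal shape) give `corank ≤ rank` at that prime, so again C3 follows from
  `NoExcessRankR2` — `pcs_selmerCap_of_noExcessRank_of_padicOrderLeRank`.

Consequence for ideation/targeting (census IDEATE-CENSUS-r1-k2g5.md §1): as a ROUTE obligation the
crux is exactly UB on `r_an ≥ 2` (first open cell `(rank, r_an) = (4, 2)` in LeadingTerm by parity);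
as a stand-alone ITEM it keeps the Ш-surplus, which only the pinch cruxes (themselves open) pay for.
Everything here is CONDITIONAL bookkeeping over route items and the named Kato fact; nothing closes
the crux.
-/

set_option linter.dupNamespace false

namespace Summit.BirchSwinnertonDyer.BirchSwinnertonDyer.Cruxes.SelmerCapAtOnePrime.PinchJunction

open scoped MatrixGroups ModularForm
open CongruenceSubgroup Literature.NumberTheory.EllipticCurves
  Literature.NumberTheory.EllipticCurves.ModularForms WeierstrassCurve
open Summit.BirchSwinnertonDyer.BirchSwinnertonDyer.Theses

/-- UB restricted to analytic rank `≥ 2` on globally minimal models ("no excess rank in the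
`r_an ≥ 2` cells"): the points-force-zeros half of BSD-rank where Gross–Zagier–Kolyvagin is silent. -/
def NoExcessRankR2 : Prop :=
  ∀ (W : WeierstrassCurve ℚ) [W.IsElliptic] [W.IsGloballyMinimal],
    2 ≤ W.analyticRank → W.mordellWeilRank ≤ W.analyticRank

/-- Kato's corank bound `corank_{ℤ_p} Sel_{p^∞}(E/ℚ) ≤ ord_{T=0} L_p(f, α_p; T)` at odd good ordinary
`p` (Kato 2004, Thm 18.4; tree fact `kato_selmerCorank_le_order_padicLFunction`), ∀-closed — the
same hypothesis shape as `Theorems.squeezeUB_parity_of_pinchPrime` (LeadingTermSqueezeUBR2Pinch.lean). -/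
def KatoAll : Prop :=
  ∀ (W : WeierstrassCurve ℚ) [W.IsElliptic] [W.IsGloballyMinimal] (p : ℕ) [Fact p.Prime]
    {N : ℕ} [NeZero N] {f : CuspForm (Gamma0 N) 2},
    kato_selmerCorank_le_order_padicLFunction W p (f := f)

/-- `rank_ℤ E(ℚ) ≤ corank_{ℤ_p} Sel_{p^∞}(E/ℚ)` at every prime, from the corank identity
`corank Sel_{p^∞} = rank + corank Ш[p^∞]` (tree theorem
`WeierstrassCurve.selmerCorank_eq_mordellWeilRank_add_holds`; Greenberg LNM 1716 §1) — local copy of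
`Theorems.mordellWeilRank_le_selmerCorank` (LeadingTermSqueezeUBR2Cells.lean), kept out of the imports. -/
theorem rank_le_selmerCorank (W : WeierstrassCurve ℚ) [W.IsElliptic] (p : ℕ) [Fact p.Prime] :
    W.mordellWeilRank ≤ W.selmerCorank p := by
  have h : W.selmerCorank p = W.mordellWeilRank + W.shaCorank p :=
    W.selmerCorank_eq_mordellWeilRank_add_holds p
  omega

/-- The two route copies of the crux are the same proposition. -/
theorem pcs_selmerCap_iff_leadingTerm_selmerCap :
    PadicCornerSqueeze.SelmerCapAtOnePrime ↔ LeadingTerm.SelmerCapAtOnePrime := Iff.rfl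

/-- **Corank = rank at the pinch prime** (route LeadingTerm). Given Kato's bound and `PinchPrime`,
every elliptic `E/ℚ` (globally minimal `W`) has a prime with `corank_{ℤ_p} Sel_{p^∞} = rank_ℤ E(ℚ)`
(equivalently `Ш(E)[p^∞]` cofinite of corank `0` there). -/
theorem corank_eq_rank_at_pinchPrime (hK : KatoAll) (hP : LeadingTerm.PinchPrime)
    (W : WeierstrassCurve ℚ) [W.IsElliptic] [W.IsGloballyMinimal] :
    ∃ (p : ℕ) (_ : Fact p.Prime), W.selmerCorank p = W.mordellWeilRank := by
  obtain ⟨p, hp, h5, hord, _D, _hD, N, hN, f, hf, horder⟩ := hP W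
  have hle : (W.selmerCorank p : ℕ∞) ≤ (W.mordellWeilRank : ℕ∞) := by
    have h := hK W p (f := f) (by omega) hord hf
    rwa [horder] at h
  have hle' : W.selmerCorank p ≤ W.mordellWeilRank := by exact_mod_cast hle
  exact ⟨p, hp, le_antisymm hle' (rank_le_selmerCorank W p)⟩

/-- The easy direction, unconditional: the crux implies UB on `r_an ≥ 2` (`rank ≤ corank`). -/
theorem noExcessRank_of_selmerCap (h : LeadingTerm.SelmerCapAtOnePrime) : NoExcessRankR2 := by
  intro W _ _ h2
  obtain ⟨p, _hp, hle⟩ := h W h2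
  exact (rank_le_selmerCorank W p).trans hle

/-- **J1 (route LeadingTerm).** Given Kato's bound and the route's crux `PinchPrime`, the crux
`SelmerCapAtOnePrime` follows from UB on `r_an ≥ 2` alone: the Ш-surplus is paid at the pinch prime. -/
theorem selmerCap_of_noExcessRank_of_pinchPrime (hK : KatoAll) (hP : LeadingTerm.PinchPrime)
    (hUB : NoExcessRankR2) : LeadingTerm.SelmerCapAtOnePrime := by
  intro W _ _ h2
  obtain ⟨p, hp, heq⟩ := corank_eq_rank_at_pinchPrime hK hP W
  exact ⟨p, hp, heq ▸ hUB W h2⟩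

/-- **J1, iff form.** Inside route LeadingTerm (Kato + `PinchPrime`) the crux IS `NoExcessRankR2`. -/
theorem selmerCap_iff_noExcessRank_of_pinchPrime (hK : KatoAll) (hP : LeadingTerm.PinchPrime) :
    LeadingTerm.SelmerCapAtOnePrime ↔ NoExcessRankR2 :=
  ⟨noExcessRank_of_selmerCap, selmerCap_of_noExcessRank_of_pinchPrime hK hP⟩

/-- **J3 (route PadicCornerSqueeze).** Given Kato's bound, the route's crux C2
`PadicOrderLeRankAtOnePrime` and a newform for every curve (the route's `Modularity` item, stated
on globally minimal models with a free level), the crux C3 = `SelmerCapAtOnePrime` follows from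
UB on `r_an ≥ 2` alone: at the prime of C2, `corank ≤ ord_T L_p ≤ rank`. -/
theorem pcs_selmerCap_of_noExcessRank_of_padicOrderLeRank (hK : KatoAll)
    (h2 : PadicCornerSqueeze.PadicOrderLeRankAtOnePrime)
    (hmod : ∀ (W : WeierstrassCurve ℚ) [W.IsElliptic] [W.IsGloballyMinimal],
      ∃ (N : ℕ) (_ : NeZero N) (f : CuspForm (Gamma0 N) 2), IsNewformOf W f)
    (hUB : NoExcessRankR2) : PadicCornerSqueeze.SelmerCapAtOnePrime := by
  intro W _ _ h2'
  obtain ⟨p, hp, hp2, hord, hle⟩ := h2 W h2'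
  obtain ⟨N, hN, f, hf⟩ := hmod W
  haveI : NeZero N := hN
  have hk : (W.selmerCorank p : ℕ∞) ≤ _ := hK W p (f := f) hp2 hord hf
  have h3 : (W.selmerCorank p : ℕ∞) ≤ (W.mordellWeilRank : ℕ∞) := hk.trans (hle f hf)
  have h3' : W.selmerCorank p ≤ W.mordellWeilRank := by exact_mod_cast h3
  exact ⟨p, hp, h3'.trans (hUB W h2')⟩

end Summit.BirchSwinnertonDyer.BirchSwinnertonDyer.Cruxes.SelmerCapAtOnePrime.PinchJunction
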